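import Mathlib
import HarnessLib
import Summits.AtomisticToContinuum.Crystallization.Theorems.PricedLinkCensusSoftLayerPropagationOneStackingMapSearchDefs
import Summits.AtomisticToContinuum.Crystallization.Theorems.PricedLinkCensusSoftLayerPropagationOneStackingMapSearchLeaf

/-!
# `stub_realBall` (crux `SoftLayerPropagation`, line `Sketch` v7): the octree COVER CHECK at the
# leaves of the development search — definitions

Route `PricedLinkCensus`, crux `SoftLayerPropagation` (stmt-AtomisticToContinuum-14233), line
`Sketch`, registered stub `stub_realBall`.  The verified development search of
`…OneStackingMapSearchDefs/Leaf.lean` (stub `stub_oneStackingMap`) enumerates every exact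
development of the graph `4`-ball; at a leaf ALL sites of the graph `5`-ball are present with
their exact shadow positions (integer vectors at scale `nn² = NN2 = 2 S²`).  This file adds a
second, purely geometric leaf verdict: **every point of the shadow ball of radius `63/20` about
the centre is within `δ` of the shadow of a graph-`5`-ball site whose own shadow radius is at most
`R`** (`δ² = dN / 1600`, `R² = Rk / 100`, in units `nn = 1`).  It is decided by an OCTREE:
a cubic box is discharged if it misses the ball (`boxDistSq`), or if some admissible site is
within `δ` of its farthest corner (`distSqFar`); otherwise it is split into its eight halves, to a
fixed depth (`coverBox`, root box `[-2¹⁴, 2¹⁴]³ ⊇` the ball).  `searchCover` / `partCover` run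
the check at the leaves below the frontier of the root exactly as `St.search` / `St.checkPart`
run the Barlow check.  Soundness is in `…RealBallCoverSound.lean`; the run (`δ = 4/5`,
`R² = 1167/100`, frontier depth `4`, `60` parts) in `…RealBallCoverRunNN.lean`.  Only computable
definitions here; all [folklore] bookkeeping.
-/

namespace Summit.AtomisticToContinuum.Crystallization.Theorems

namespace OneStacking

namespace St

open V3

/-! ### Integer box geometry (boxes `bl + [0, size]³`) -/

/-- On one axis: the larger of the distances from the coordinate `pc` to the two ends of
`[l, l + size]`. [folklore] -/
def farAxis (pc l size : ℤ) : ℤ := max (Int.natAbs (l - pc) : ℤ) (Int.natAbs (l + size - pc) : ℤ)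

/-- Squared distance from `p` to the farthest corner of the box `bl + [0, size]³`. [folklore] -/
def distSqFar (p bl : V3) (size : ℤ) : ℤ :=
  farAxis p.x bl.x size ^ 2 + farAxis p.y bl.y size ^ 2 + farAxis p.z bl.z size ^ 2

/-- On one axis: the distance from `0` to `[l, l + size]`. [folklore] -/
def nearAxis (l size : ℤ) : ℤ := if 0 < l then l else if l + size < 0 then -(l + size) else 0

/-- Squared distance from the origin to the box `bl + [0, size]³`. [folklore] -/
def boxDistSq (bl : V3) (size : ℤ) : ℤ :=
  nearAxis bl.x size ^ 2 + nearAxis bl.y size ^ 2 + nearAxis bl.z size ^ 2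

/-- Squared distance from `p` to the box `bl + [0, size]³` (used only to thin the list of
candidate sites passed to the sub-boxes; soundness does not depend on it). [folklore] -/
def boxPointDistSq (p bl : V3) (size : ℤ) : ℤ :=
  nearAxis (bl.x - p.x) size ^ 2 + nearAxis (bl.y - p.y) size ^ 2 + nearAxis (bl.z - p.z) size ^ 2

/-- The eight half-boxes of `bl + [0, 2h]³`. [folklore] -/
def kids (bl : V3) (h : ℤ) : List V3 :=
  [⟨bl.x, bl.y, bl.z⟩, ⟨bl.x + h, bl.y, bl.z⟩, ⟨bl.x, bl.y + h, bl.z⟩, ⟨bl.x + h, bl.y + h, bl.z⟩,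
   ⟨bl.x, bl.y, bl.z + h⟩, ⟨bl.x + h, bl.y, bl.z + h⟩, ⟨bl.x, bl.y + h, bl.z + h⟩,
   ⟨bl.x + h, bl.y + h, bl.z + h⟩]

/-! ### The octree cover check -/

/-- **The octree.**  `coverBox dN pts d bl size = true` certifies: every point of the box
`bl + [0, size]³` that lies in the shadow ball `400 |x|² ≤ 3969 NN2` (radius `63/20 nn`) is
within `δ`, `1600 δ² = dN · NN2`, of some point of `pts`.  A box is discharged when it misses
the ball or when some point is within `δ` of its farthest corner; otherwise (depth permitting) its
eight halves are checked against the points within `δ` of the box. [folklore] -/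
def coverBox (dN : ℤ) (pts : List V3) : ℕ → V3 → ℤ → Bool
  | 0, bl, size =>
    decide (3969 * NN2 < 400 * boxDistSq bl size) ||
      pts.any (fun p => decide (1600 * distSqFar p bl size ≤ dN * NN2))
  | d + 1, bl, size =>
    if 3969 * NN2 < 400 * boxDistSq bl size then true
    else if pts.any (fun p => decide (1600 * distSqFar p bl size ≤ dN * NN2)) then true
    else
      let h := size / 2
      let pts' := pts.filter fun p => decide (1600 * boxPointDistSq p bl size ≤ dN * NN2)
      (kids bl h).all fun c => coverBox dN pts' d c h

/-- **The cover check of a state**: the octree of depth `depth` on the root box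
`[-2¹⁴, 2¹⁴]³`, fed with the positions of the sites of shadow radius `≤ R`,
`100 R² = Rk` (all sites of a state have level `≤ 5`). [folklore] -/
def coverCheck (dN Rk : ℤ) (depth : ℕ) (s : St) : Bool :=
  let pts := ((List.range s.size).filter fun a => decide (100 * V3.n2 (s.pos a) ≤ Rk * NN2)).map s.pos
  coverBox dN pts depth ⟨-16384, -16384, -16384⟩ 32768

/-- **The search with the cover check at the leaves** (same tree as `St.search`). [folklore] -/
def searchCover (dN Rk : ℤ) (depth : ℕ) (tbl : List CEntry) : ℕ → St → Bool
  | 0, _ => false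
  | fuel + 1, s =>
    if s.cur < s.size ∧ s.lvl s.cur ≤ 4 then
      match s.options tbl with
      | none => false
      | some opts => opts.all (searchCover dN Rk depth tbl fuel)
    else coverCheck dN Rk depth s

/-- Part `idx` of `parts` of the cover search below the depth-`d` frontier of the root (round
robin), each frontier state searched with fuel `fuel` (same splitting as `St.checkPart`).
[folklore] -/
def partCover (dN Rk : ℤ) (depth d parts idx fuel : ℕ) : Bool :=
  let tbl := TABLE
  match frontier tbl 4000 d root with
  | none => false
  | some fr => ((List.range fr.length).filter fun t => t % parts = idx).all fun t =>
      match fr[t]? with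
      | none => false
      | some s => searchCover dN Rk depth tbl fuel s

end St

end OneStacking

end Summit.AtomisticToContinuum.Crystallization.Theorems
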